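import Summits.ResolutionOfSingularities.ResolutionOfSingularities.Theorems.WeightedInvariantHypersurfaceCentreAssemblyStubExists
import Summits.ResolutionOfSingularities.ResolutionOfSingularities.Theorems.WeightedInvariantHypersurfaceCentreAssemblyStubRegular
import Summits.ResolutionOfSingularities.ResolutionOfSingularities.Theorems.WeightedInvariantHypersurfaceCentreConstructionStubIsHomogeneous
import Summits.ResolutionOfSingularities.ResolutionOfSingularities.Theorems.WeightedInvariantHypersurfaceCentreAssemblyStubIotaDrop
import HarnessLib

/-!
# Door line `local-engine` (skeleton v3.12, 7a4b52ef4f5779aa) — registry closers for the sub-stubs [S3]–[S6]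

Route `ResolutionOfSingularities/WeightedInvariant`, crux `Theses.WeightedInvariant.HypersurfaceCentreConstruction`
(stmt-ResolutionOfSingularities-19897).  The four LINE-tier sub-stubs [S3] `stub_exists_isCanonicalCentre`, [S4]
`stub_isRegularWeightedCentre_of_isCanonicalCentre`, [S5] `stub_isHomogeneous_of_isCanonicalCentre` and [S6]
`stub_iotaMax_lt_of_step` of the registered skeleton are tree theorems (files `…CentreAssemblyStubExists` p507446,
`…CentreAssemblyStubRegular` p506882, `…CentreConstructionStubIsHomogeneous` p503996, `…CentreAssemblyStubIotaDrop`),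
landed BEFORE the current skeleton registration (2026-08-27T21:58:20Z), so the registry still lists them active.  This
file restates each registered signature VERBATIM (`p`, `ι`, `J` section variables as in the skeleton) in the namespace
complementary to the tree theorem's and closes it by that theorem — bookkeeping only, no new mathematics.
OURS; AI-written; no claim about Hironaka's problem.
-/

noncomputable section

set_option linter.dupNamespace false -- mandated namespace of this single-conjunct summit

open CategoryTheory AlgebraicGeometry TopologicalSpace IsLocalRing
open Literature.AlgebraicGeometry.Resolution

namespace Summit.ResolutionOfSingularities.ResolutionOfSingularities.Cruxes.HypersurfaceCentreConstruction.LocalEngine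

open Summit.ResolutionOfSingularities.ResolutionOfSingularities.Theorems

section Stubs

variable {p : ℕ} (ι : (R : Type) → [CommRing R] → R → Ordinal.{0})
  (J : (R : Type) → [CommRing R] → R → ℕ → Ideal R)

/-- [S3] **Existence of the canonical centre** (registered signature verbatim; closed by the tree theorem
`Theorems.stub_exists_isCanonicalCentre`, p507446). [cite: Wlodarczyk2022, §2.2 and 2.1.10] -/
theorem stub_exists_isCanonicalCentre (hc6 : IotaIsoInvariant ι) (hc8 : IotaUpperSemicontinuous ι)
    (hu : IotaUnitInvariant ι) (hJ : JIsoInvariant J) (hJu : JUnitInvariant J) (hgame : CanonicalGameClause p ι J)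
    (hopen : JOpenPresentationForallSing p ι J)
    {k : Type} [Field k] [CharP k p] [PerfectField k] {Y : Scheme.{0}} (f : Y ⟶ Spec (.of k)) [Smooth f]
    [IsSeparated f] [QuasiCompact f] (X : Y.IdealSheafData) (hX : IsLocallyPrincipal X)
    (hXi : IsIntegral X.subscheme) (hsing : ¬ Scheme.IsRegular X.subscheme) :
    ∃ R : ReesAlgebraData Y, IsCanonicalCentre ι J X R :=
  Summit.ResolutionOfSingularities.ResolutionOfSingularities.Theorems.stub_exists_isCanonicalCentre ι J hc6 hc8 hu hJ
    hJu hgame hopen f X hX hXi hsing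

/-- [S5] **The canonical centre is homogeneous on every torus chart of the pair** (registered signature verbatim; closed by
the tree theorem `Theorems.stub_isHomogeneous_of_isCanonicalCentre`, p503996). [cite: Wlodarczyk2022, Thm. 1.1.4 (6)] -/
theorem stub_isHomogeneous_of_isCanonicalCentre (hc6 : IotaIsoInvariant ι) (hu : IotaUnitInvariant ι)
    (hJ : JIsoInvariant J) (hJu : JUnitInvariant J) (hJs : IotaJEssSmoothCompatible ι J)
    {k : Type} [Field k] [CharP k p] [PerfectField k] {Y : Scheme.{0}} (f : Y ⟶ Spec (.of k)) [Smooth f]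
    [IsSeparated f] [QuasiCompact f] (X : Y.IdealSheafData) (hX : IsLocallyPrincipal X)
    (hXi : IsIntegral X.subscheme) (hsing : ¬ Scheme.IsRegular X.subscheme)
    (R : ReesAlgebraData Y) (hR : IsCanonicalCentre ι J X R)
    {j : ℕ} (W : Y.affineOpens) (𝒢 : (Fin j → ℤ) → AddSubgroup Γ(Y, W)) [GradedRing 𝒢]
    (h0 : ∀ c : Γ(Spec (.of k), ⊤), f.appLE ⊤ W le_top c ∈ 𝒢 0) (hXhom : (X.ideal W).IsHomogeneous 𝒢) (n : ℕ) :
    ((R.piece n).ideal W).IsHomogeneous 𝒢 :=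
  Summit.ResolutionOfSingularities.ResolutionOfSingularities.Theorems.stub_isHomogeneous_of_isCanonicalCentre ι J hc6 hu
    hJ hJu hJs f X hX hXi hsing R hR W 𝒢 h0 hXhom n

end Stubs

end Summit.ResolutionOfSingularities.ResolutionOfSingularities.Cruxes.HypersurfaceCentreConstruction.LocalEngine

namespace Summit.ResolutionOfSingularities.ResolutionOfSingularities.Theorems

open Summit.ResolutionOfSingularities.ResolutionOfSingularities.Cruxes.HypersurfaceCentreConstruction.LocalEngine

section Stubs

variable {p : ℕ} (ι : (R : Type) → [CommRing R] → R → Ordinal.{0})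
  (J : (R : Type) → [CommRing R] → R → ℕ → Ideal R)

/-- [S4] **The canonical centre is a regular weighted centre** (registered signature verbatim; closed by the tree theorem
`LocalEngine.stub_isRegularWeightedCentre_of_isCanonicalCentre`, p506882). [cite: Wlodarczyk2022, 2.1.10] -/
theorem stub_isRegularWeightedCentre_of_isCanonicalCentre (hc6 : IotaIsoInvariant ι) (hc8 : IotaUpperSemicontinuous ι)
    (hu : IotaUnitInvariant ι) (hJ : JIsoInvariant J) (hJu : JUnitInvariant J) (hgame : CanonicalGameClause p ι J)
    (hopen : JOpenPresentationForallSing p ι J)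
    {k : Type} [Field k] [CharP k p] [PerfectField k] {Y : Scheme.{0}} (f : Y ⟶ Spec (.of k)) [Smooth f]
    [IsSeparated f] [QuasiCompact f] (X : Y.IdealSheafData) (hX : IsLocallyPrincipal X)
    (hXi : IsIntegral X.subscheme) (hsing : ¬ Scheme.IsRegular X.subscheme)
    (R : ReesAlgebraData Y) (hR : IsCanonicalCentre ι J X R) : R.IsRegularWeightedCentre :=
  Summit.ResolutionOfSingularities.ResolutionOfSingularities.Cruxes.HypersurfaceCentreConstruction.LocalEngine.stub_isRegularWeightedCentre_of_isCanonicalCentre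
    ι J hc6 hc8 hu hJ hJu hgame hopen f X hX hXi hsing R hR

/-- [S6] **The maximum of `ι` drops along a cobordant blow-up of the canonical centre** (registered signature verbatim;
closed by the tree theorem `LocalEngine.stub_iotaMax_lt_of_step`). [cite: Wlodarczyk2022, Thm. 4.3.1] -/
theorem stub_iotaMax_lt_of_step (hc6 : IotaIsoInvariant ι) (hc7 : IotaGenerizationMonotone ι)
    (hc8 : IotaUpperSemicontinuous ι) (hc10 : IotaTorusFactorMonotone ι) (hu : IotaUnitInvariant ι) (hJ : JIsoInvariant J) (hJu : JUnitInvariant J)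
    (hJs : IotaJEssSmoothCompatible ι J) (hgame : CanonicalGameClause p ι J)
    (hopen : JOpenPresentationForallSing p ι J)
    {k : Type} [Field k] [CharP k p] [PerfectField k]
    (c : ∀ ⦃Y : Scheme.{0}⦄, (Y ⟶ Spec (.of k)) → Y.IdealSheafData → ReesAlgebraData Y)
    (hc : ∀ ⦃Y : Scheme.{0}⦄ (f : Y ⟶ Spec (.of k)) [Smooth f] [IsSeparated f] [QuasiCompact f]
      (X : Y.IdealSheafData), IsLocallyPrincipal X → IsIntegral X.subscheme → ¬ Scheme.IsRegular X.subscheme →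
      IsCanonicalCentre ι J X (c f X))
    (P' P : HypersurfacePair k) (h : HypersurfacePair.Step c P' P) : iotaMax ι P'.X < iotaMax ι P.X :=
  Summit.ResolutionOfSingularities.ResolutionOfSingularities.Cruxes.HypersurfaceCentreConstruction.LocalEngine.stub_iotaMax_lt_of_step
    ι J hc6 hc7 hc8 hc10 hu hJ hJu hJs hgame hopen c hc P' P h

end Stubs

end Summit.ResolutionOfSingularities.ResolutionOfSingularities.Theorems

end
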